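import Summits.ResolutionOfSingularities.ResolutionOfSingularities.Theorems.HilbertSamuelEliminationSigmaMaxModificationsCorridor3SigmaSurfaceBadnessTrueSet
import Summits.ResolutionOfSingularities.ResolutionOfSingularities.Theorems.HilbertSamuelEliminationSigmaMaxModificationsCorridor3SigmaMenuSurfaceCureStepLaws
import Summits.ResolutionOfSingularities.ResolutionOfSingularities.Theorems.HilbertSamuelEliminationSigmaMaxModificationsCorridor3SigmaMenuSurfaceExhaustive
import Literature.AlgebraicGeometry.Resolution.RegularLocalRingsQuotient
import Literature.AlgebraicGeometry.Resolution.RegularLocalRingsUFD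
import Literature.AlgebraicGeometry.Resolution.MonomializationAlongValuation
import Literature.AlgebraicGeometry.Resolution.SncStrata
import Literature.AlgebraicGeometry.Resolution.PrimeDivisorIdeals
import HarnessLib

/-!
# [OURS · L1 W4.2] σ-LAYER PHASE B′ — `Corridor3SigmaSurfaceBadnessOfReady`: THE FORWARD (R-a) — READY (list-snc ∧ TS′) ⇒ `M = 0`; the case rule of record is silent
# EXACTLY on READY surfaces (crux chain w42 `SigmaMaxModifications` stmt-ResolutionOfSingularities-18506 / conjunct `SigmaMaxModificationsCorridor3`
# stmt-ResolutionOfSingularities-19249; res-L1-w42-stub-1 (gen 6); `--supports stmt-…-19249 --as helper`, counted 0)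

HONEST FRAMING. OURS bookkeeping closing the loop between res-type-067's list-level readiness (`HasSNC (E.restrictOff ι_D)`, BGMW Def. 3.1.1 via Literature `HasSNCWith`;
`ReadyOfRecord` p540435) with the repaired true-set clause (TS′) of `…SurfaceBadnessTrueSet` (p573186) and this seat's badness count `M` (p559520). NOTHING here is a
statement of H. Hironaka's manuscript [Hironaka2017] nor of [CossartJannsenSaito2020]; AI-typed; AI review is weaker than expert review.

* **`Boundary.crossingPts_eq_empty_of_hasSNC`**: a list-snc configuration has NO crossing points — at `x`, `Γ_x = (u_i)` with `u_i` a regular parameter, a PRIME element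
  (`IsRegularLocalRing.prime_of_not_mem_sq`), so every codimension-one point `ζ ⤳ x` of `supp Γ` has `𝔭_ζ = (u_i)` (height-one primes of the factorial `𝒪_x` are principal
  prime, `exists_prime_primeOfSpecializes_eq_span`; `u_i ∈ 𝔭_ζ`), and `𝔭_ζ` determines `ζ` (`specializes_of_primeOfSpecializes_le`, Stacks 01J7).
* **`Boundary.compMults_eq_singleton_of_hasSNC_of_nodupNE`**: list-snc ∧ (TS′) ⇒ `compMults ζ = [1]` at every codimension-one point — at `ζ` (`dim 𝒪_ζ = 1`) the
  distinct members through `ζ` inject into `Fin 1`, so ONE value `Γ` passes, with `Γ_ζ = (u_0) = 𝔪_ζ` (order `1`); (TS′) makes it pass ONCE as a list entry.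
* **`Boundary.badness_eq_zero_of_hasSNC_of_nodupNE`**, run shape **`badOfRecord_eq_zero_of_readyOfRecord_of_nodupNE`** / `…_of_readyTSOfRecord`, and the symmetric
  silence law **`not_cureStepOfRecord_of_readyOfRecord_of_nodupNE`** (o1's cure of record does not fire on READY surfaces; twin of 067/o1's
  `not_pointStepOfRecord_of_readyOfRecord`). With `…MenuSurfaceExhaustive`: the case rule of record is silent IFF the surface is READY (TS′ form) —
  **`forall_not_ofRecord_iff_ready_of_mem_surfaceComponents`**.
-/

noncomputable section

set_option linter.dupNamespace false -- mandated namespace of this single-conjunct summit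

open CategoryTheory AlgebraicGeometry TopologicalSpace IsLocalRing
open Summit.ResolutionOfSingularities.ResolutionOfSingularities.Theorems.CampaignW42
open Literature.AlgebraicGeometry.Resolution Literature.RingTheory.HilbertSamuel

namespace Summit.ResolutionOfSingularities.ResolutionOfSingularities.Theorems.SigmaMaxModificationsCorridor3.Sigma

universe u

open Scheme.IdealSheafData

/-! ## §1. Carrier: list-snc ⇒ no crossings; list-snc ∧ (TS′) ⇒ `compMults = [1]`; hence `badness = 0` -/

section Carrier

variable {D : Scheme.{u}} {Γs : Boundary D}

/-- A member of a minimal generating family `u : Fin (spanFinrank 𝔪) → R` of `𝔪` is a PRIME element of the regular local ring `R`. [folklore] -/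
theorem prime_of_span_range_eq_maximalIdeal {R : Type u} [CommRing R] [IsRegularLocalRing R] (u : Fin (maximalIdeal R).spanFinrank → R)
    (hu : Ideal.span (Set.range u) = maximalIdeal R) (i : Fin (maximalIdeal R).spanFinrank) : Prime (u i) := by
  classical
  have hmem : u i ∈ maximalIdeal R := hu ▸ Ideal.subset_span (Set.mem_range_self i)
  refine IsRegularLocalRing.prime_of_not_mem_sq hmem ?_
  refine not_mem_sq_of_span_eq_maximalIdeal (Finset.univ.image u) (by simpa using hu) ?_ (by simp)
  exact Finset.card_image_le.trans (by simp)

/-- **LIST-SNC ⇒ NO CROSSING POINTS.** [folklore] -/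
theorem Boundary.crossingPts_eq_empty_of_hasSNC (hsnc : HasSNC Γs) {Γ : D.IdealSheafData} (hΓ : Γ ∈ Γs) : Γs.crossingPts Γ = ∅ := by
  ext x
  simp only [Set.mem_empty_iff_false, iff_false]
  rintro ⟨⟨ζ₁, hζ₁, ζ₂, hζ₂, hne, h₁, h₂⟩, -⟩
  rw [mem_divisorialPoints_iff] at hζ₁ hζ₂
  obtain ⟨hregx, u, hu, ⟨ι, -, hD⟩, -⟩ := hsnc x
  haveI := isDomain_of_isRegularLocalRing (D.presheaf.stalk x)
  haveI := IsRegularLocalRing.uniqueFactorizationMonoid (D.presheaf.stalk x)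
  have hx : x ∈ (Γ.support : Set D) :=
    Γ.support.isClosed.closure_subset_iff.mpr (Set.singleton_subset_iff.mpr hζ₁.1) h₁.mem_closure
  have hst : stalkIdeal Γ x = Ideal.span {u (ι ⟨Γ, hΓ, hx⟩)} := hD ⟨Γ, hΓ, hx⟩
  have hprime : Prime (u (ι ⟨Γ, hΓ, hx⟩)) := prime_of_span_range_eq_maximalIdeal u hu _
  have key : ∀ {ζ : D} (h : ζ ⤳ x), ζ ∈ (Γ.support : Set D) → Order.coheight ζ = 1 →
      primeOfSpecializes h = Ideal.span {u (ι ⟨Γ, hΓ, hx⟩)} := by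
    intro ζ h hζs hζ1
    have hle : Ideal.span {u (ι ⟨Γ, hΓ, hx⟩)} ≤ primeOfSpecializes h :=
      hst ▸ (mem_support_iff_stalkIdeal_le_primeOfSpecializes Γ h).mp hζs
    obtain ⟨p, hp, hpeq⟩ := exists_prime_primeOfSpecializes_eq_span h hζ1
    rw [hpeq] at hle ⊢
    have hdvd : p ∣ u (ι ⟨Γ, hΓ, hx⟩) := Ideal.mem_span_singleton.mp (hle (Ideal.mem_span_singleton_self _))
    exact Ideal.span_singleton_eq_span_singleton.mpr (hp.irreducible.associated_of_dvd hprime.irreducible hdvd)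
  have e₁ := key h₁ hζ₁.1 hζ₁.2
  have e₂ := key h₂ hζ₂.1 hζ₂.2
  have h12 : ζ₁ ⤳ ζ₂ := specializes_of_primeOfSpecializes_le h₂ h₁ (by rw [e₁, e₂])
  have h21 : ζ₂ ⤳ ζ₁ := specializes_of_primeOfSpecializes_le h₁ h₂ (by rw [e₁, e₂])
  exact hne (h12.antisymm h21).eq

/-- Hence the crossing count of a list-snc configuration vanishes. [folklore] -/
theorem Boundary.crossingCount_eq_zero_of_hasSNC (hsnc : HasSNC Γs) : Γs.crossingCount = 0 := by
  unfold Boundary.crossingCount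
  refine List.sum_eq_zero fun n hn => ?_
  obtain ⟨Γ, hΓ, rfl⟩ := List.mem_map.mp hn
  rw [Boundary.crossingPts_eq_empty_of_hasSNC hsnc hΓ, Set.ncard_empty]

/-- **AT A CODIMENSION-ONE POINT OF A LIST-SNC CONFIGURATION exactly one member VALUE passes, with order one**: every member through `ζ` has `Γ_ζ = 𝔪_ζ`, and any two
members through `ζ` are EQUAL as ideal sheaves. [folklore] -/
theorem Boundary.stalkIdeal_eq_maximalIdeal_of_hasSNC [IsIntegral D] [IsLocallyNoetherian D] (hsnc : HasSNC Γs) {ζ : D} (hζ : Order.coheight ζ = 1)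
    {Γ : D.IdealSheafData} (hΓ : Γ ∈ Γs) (hζΓ : ζ ∈ (Γ.support : Set D)) :
    stalkIdeal Γ ζ = maximalIdeal (D.presheaf.stalk ζ) ∧
      ∀ Γ' ∈ Γs, ζ ∈ (Γ'.support : Set D) → Γ' = Γ := by
  obtain ⟨hregζ, u, hu, ⟨ι, hι, hD⟩, -⟩ := hsnc ζ
  have hr : (maximalIdeal (D.presheaf.stalk ζ)).spanFinrank = 1 := by
    have h1 := IsRegularLocalRing.spanFinrank_maximalIdeal (R := D.presheaf.stalk ζ)
    rw [ringKrullDim_stalk_eq_coheight, hζ] at h1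
    exact_mod_cast h1
  -- all indices are `0`: `Fin 1`
  have hidx : ∀ a b : Fin (maximalIdeal (D.presheaf.stalk ζ)).spanFinrank, a = b := by
    rw [hr]; exact fun a b => Subsingleton.elim a b
  have hspan : ∀ i, Ideal.span {u i} = maximalIdeal (D.presheaf.stalk ζ) := by
    intro i
    rw [← hu]
    congr 1
    ext y
    simp only [Set.mem_singleton_iff, Set.mem_range]
    exact ⟨fun h => ⟨i, h.symm⟩, fun ⟨j, hj⟩ => hidx j i ▸ hj.symm⟩
  refine ⟨(hD ⟨Γ, hΓ, hζΓ⟩).trans (hspan _), fun Γ' hΓ' hζΓ' => ?_⟩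
  have := hι (hidx (ι ⟨Γ', hΓ', hζΓ'⟩) (ι ⟨Γ, hΓ, hζΓ⟩))
  exact congrArg Subtype.val this

open scoped Classical in
/-- **LIST-SNC ∧ (TS′) ⇒ `compMults ζ = [1]`** at every codimension-one point of the configuration. [folklore] -/
theorem Boundary.compMults_eq_singleton_of_hasSNC_of_nodupNE [IsIntegral D] [IsLocallyNoetherian D] (hsnc : HasSNC Γs)
    (hnd : (Γs.filter fun Γ => Γ ≠ ⊤).Nodup) {ζ : D} (hζ : ζ ∈ Γs.codimOnePoints) : Γs.compMults ζ = [1] := by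
  obtain ⟨Γ, hΓ, hζΓ⟩ := Boundary.mem_divisorSet_iff.mp hζ.1
  obtain ⟨hst, huniq⟩ := Boundary.stalkIdeal_eq_maximalIdeal_of_hasSNC hsnc hζ.2 hΓ hζΓ
  -- the list of members through `ζ` is `[Γ]`
  have hall : ∀ Γ' ∈ membersThrough Γs ζ, Γ' = Γ := fun Γ' h =>
    huniq Γ' (mem_membersThrough_iff.mp h).1 (mem_membersThrough_iff.mp h).2
  have hΓtop : Γ ≠ ⊤ := by
    intro h; rw [h, Scheme.IdealSheafData.support_top] at hζΓ; exact hζΓ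
  have hcount : (membersThrough Γs ζ).count Γ ≤ 1 := by
    have h1 : Γs.count Γ ≤ 1 := by
      rw [← List.count_filter (p := fun Γ : D.IdealSheafData => decide (Γ ≠ ⊤)) (l := Γs) (by simpa using hΓtop)]
      exact List.nodup_iff_count_le_one.mp hnd Γ
    exact ((membersThrough_sublist Γs ζ).count_le Γ).trans h1
  have hmem : Γ ∈ membersThrough Γs ζ := mem_membersThrough_iff.mpr ⟨hΓ, hζΓ⟩
  have hrep : membersThrough Γs ζ = List.replicate (membersThrough Γs ζ).length Γ := List.eq_replicate_iff.mpr ⟨rfl, hall⟩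
  have hlen : (membersThrough Γs ζ).length = 1 := by
    have hle : (membersThrough Γs ζ).length ≤ 1 := by
      have := hcount; rw [hrep, List.count_replicate_self] at this; simpa using this
    have hpos : 0 < (membersThrough Γs ζ).length := List.length_pos_of_mem hmem
    omega
  have hlist : membersThrough Γs ζ = [Γ] := by rw [hrep, hlen]; rfl
  unfold Boundary.compMults
  rw [hlist, List.map_singleton, idealOrder_eq_of_stalkIdeal_eq_pow hζ.2 (by rw [hst, pow_one])]
  rfl

open scoped Classical in
/-- **LIST-SNC ∧ (TS′) ⇒ `badness = 0`** (no finiteness premise needed: every summand vanishes). [folklore] -/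
theorem Boundary.badness_eq_zero_of_hasSNC_of_nodupNE [IsIntegral D] [IsLocallyNoetherian D] (hsnc : HasSNC Γs)
    (hnd : (Γs.filter fun Γ => Γ ≠ ⊤).Nodup) : Γs.badness = 0 := by
  unfold Boundary.badness
  rw [Boundary.crossingCount_eq_zero_of_hasSNC hsnc, mul_zero, add_zero]
  refine finsum_mem_of_eqOn_zero fun ζ hζ => ?_
  rw [Boundary.compBadness_eq, Boundary.compMults_eq_singleton_of_hasSNC_of_nodupNE hsnc hnd hζ]
  rfl

end Carrier

/-! ## §2. Run shape: READY ⇒ `M = 0`; the cure of record is silent on READY surfaces; silent ↔ READY -/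

section Surface

variable {W : Scheme.{u}} {hW : IsLocallyNoetherian W} {N : ℕ} {ν : ℕ → ℕ} {L : Labelling W} {P : Option (Pending W)} {E : Boundary W} {D : Closeds W}
  {C : W.IdealSheafData}

open scoped Classical in
/-- **READY (rev 1) ∧ (TS′) ⇒ `M(E, D) = 0`** (irreducible `D`, `W` locally Noetherian). [folklore] -/
theorem badOfRecord_eq_zero_of_readyOfRecord_of_nodupNE [IsLocallyNoetherian (menuCentre D).subscheme] (hDirr : IsIrreducible (D : Set W)) (hR : ReadyOfRecord W E N ν D)
    (hnd : ((E.restrictOff (menuCentre D).subschemeι).filter fun Γ => Γ ≠ ⊤).Nodup) : badOfRecord W E D = 0 := by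
  haveI : IsIntegral (menuCentre D).subscheme := isIntegral_subscheme_vanishingIdeal D hDirr
  rw [badOfRecord_eq]
  exact Boundary.badness_eq_zero_of_hasSNC_of_nodupNE hR.2 hnd

/-- **READY-TS (as typed) ⇒ `M(E, D) = 0`.** [folklore] -/
theorem badOfRecord_eq_zero_of_readyTSOfRecord [IsLocallyNoetherian (menuCentre D).subscheme] (hDirr : IsIrreducible (D : Set W)) (hR : ReadyTSOfRecord W E N ν D) :
    badOfRecord W E D = 0 := by
  classical
  exact badOfRecord_eq_zero_of_readyOfRecord_of_nodupNE hDirr hR.readyOfRecord (hR.nodup.filter _)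

open scoped Classical in
/-- **READY ⇒ the ℓ-gated count vanishes too.** [folklore] -/
theorem badGatedOfRecord_eq_zero_of_readyOfRecord_of_nodupNE [IsLocallyNoetherian (menuCentre D).subscheme] (hDirr : IsIrreducible (D : Set W)) (hR : ReadyOfRecord W E N ν D)
    (hnd : ((E.restrictOff (menuCentre D).subschemeι).filter fun Γ => Γ ≠ ⊤).Nodup) : badGatedOfRecord W E D = 0 :=
  (badGatedOfRecord_eq_zero_iff E D).mpr (Or.inr (badOfRecord_eq_zero_of_readyOfRecord_of_nodupNE hDirr hR hnd))

open scoped Classical in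
/-- **THE CURE OF RECORD IS SILENT ON READY SURFACES** (twin of `not_pointStepOfRecord_of_readyOfRecord`): irreducible `D` with Noetherian `D̃` of dimension `≤ 2`.
[folklore] -/
theorem not_cureStepOfRecord_of_readyOfRecord_of_nodupNE [AlgebraicGeometry.IsNoetherian (menuCentre D).subscheme]
    (hDirr : IsIrreducible (D : Set W)) (hdim : topologicalKrullDim ↥(menuCentre D).subscheme ≤ 2) (hR : ReadyOfRecord W E N ν D)
    (hnd : ((E.restrictOff (menuCentre D).subschemeι).filter fun Γ => Γ ≠ ⊤).Nodup) : ¬ cureStepOfRecord W hW N ν L P E D C := by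
  intro hc
  have hpos := (exists_cureStepOfRecord_iff_badOfRecord_pos (hW := hW) (N := N) (ν := ν) (L := L) (P := P) (E := E) hDirr hdim).mp ⟨C, hc⟩
  rw [badOfRecord_eq_zero_of_readyOfRecord_of_nodupNE hDirr hR hnd] at hpos
  exact lt_irrefl 0 hpos

open scoped Classical in
/-- **THE WHOLE CASE RULE OF RECORD IS SILENT ON READY SURFACES** whenever its regularity reading holds there (`regular W D`; any `phaseS`). [folklore] -/
theorem not_ofRecord_of_readyOfRecord_of_nodupNE [AlgebraicGeometry.IsNoetherian (menuCentre D).subscheme]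
    {regular : SurfaceRegularity.{u}} {phaseS : SurfacePrep.{u}} (hr : regular W D) (hDirr : IsIrreducible (D : Set W))
    (hdim : topologicalKrullDim ↥(menuCentre D).subscheme ≤ 2) (hR : ReadyOfRecord W E N ν D)
    (hnd : ((E.restrictOff (menuCentre D).subschemeι).filter fun Γ => Γ ≠ ⊤).Nodup) :
    ¬ SurfacePrep.ofRecord regular phaseS badGatedOfRecord cureStepOfRecord pointStepOfRecord W hW N ν L P E D C := by
  intro h
  rcases (SurfacePrep.ofRecord_iff).mp h with ⟨hnr, -⟩ | ⟨-, -, hc⟩ | ⟨-, -, hp⟩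
  · exact hnr hr
  · exact not_cureStepOfRecord_of_readyOfRecord_of_nodupNE hDirr hdim hR hnd hc
  · exact not_pointStepOfRecord_of_readyOfRecord hR hp

open scoped Classical in
/-- **SILENT ↔ READY (TS′ form) — THE CASE RULE OF RECORD IS SILENT EXACTLY ON READY SURFACES** (on a surface component of `X(ν)` with `D̃` Noetherian regular excellent,
`regular W D`, members locally principal; the «⇒» half is `…MenuSurfaceExhaustive` modulo F-75c). DESIGN CHECK 1 in both directions, by name. [folklore] -/
theorem forall_not_ofRecord_iff_ready_of_mem_surfaceComponents (hF : Stacks0BIC_embeddedResolutionCurvesInSurfaces_locus.{u})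
    [AlgebraicGeometry.IsNoetherian (menuCentre D).subscheme] {regular : SurfaceRegularity.{u}} {phaseS : SurfacePrep.{u}}
    (hD : (D : Set W) ∈ surfaceComponents W N ν) (hr : regular W D) (hreg : Scheme.IsRegular (menuCentre D).subscheme)
    (hexc : Scheme.IsExcellent (menuCentre D).subscheme) (hE : ∀ B ∈ E, IsLocallyPrincipal B) :
    (∀ C : W.IdealSheafData, ¬ SurfacePrep.ofRecord regular phaseS badGatedOfRecord cureStepOfRecord pointStepOfRecord W hW N ν L P E D C) ↔
      (ReadyOfRecord W E N ν D ∧ ((E.restrictOff (menuCentre D).subschemeι).filter fun Γ => Γ ≠ ⊤).Nodup) := by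
  refine ⟨fun h => readyOfRecord_and_nodupNE_of_forall_not_ofRecord_of_mem_surfaceComponents hF hD h hr hreg hexc hE, fun ⟨hR, hnd⟩ C => ?_⟩
  exact not_ofRecord_of_readyOfRecord_of_nodupNE hr (componentsIn.isIrreducible hD.1)
    (topologicalKrullDim_menuCentre_subscheme_of_mem_surfaceComponents hD).le hR hnd

end Surface

end Summit.ResolutionOfSingularities.ResolutionOfSingularities.Theorems.SigmaMaxModificationsCorridor3.Sigma

end
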